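import Literature.NumberTheory.EllipticCurves.HalfIntegralWeightFormsThetaMultiplierProofs
import Literature.NumberTheory.EllipticCurves.HalfIntegralWeightThetaMultiplier
import Literature.NumberTheory.EllipticCurves.HalfIntegralWeightGaussSumsTwo
import HarnessLib

/-!
# The weight-`3/2` theta series `Θ′(z) = ∑ χ₋₄(n) n e(n² z)` and its transformation law on `Γ₀(64)`

[[cite: Shimura1973HalfIntegral, §2, Prop. 2.2]] — the theta series `θ(z, ψ) = ∑ ψ(n) n e(n²z)`
attached to an odd character `ψ` of conductor `r` is a cusp form of weight `3/2` on `Γ₀(4r²)` with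
character `ψ χ₋₄`.  Here `ψ = χ₋₄` (`r = 4`): `Θ′(z) = ∑_{n ∈ ℤ} χ₋₄(n) n e(n²z) = 2 η(8z)³`
(Jacobi), level `64`, trivial character.  It is the factor of the CM newform
`φ₆₄ = ½ Θ′ θ₄ = η(8z)⁸/(η(4z)²η(16z)²)` of the congruent number curve `E₂` (64a) used by the
Shintani-lift route to `tunnell_converse_even` (sequel `Phi64`).  We PROVE, following the tree's
`HalfIntegralWeightThetaTransformation` (Poisson summation on residue classes) with the linear
factor handled by Mathlib's `jacobiTheta₂'` and its functional equation:

* `hasSum_linear_mul_cexp_sq_add` — `∑_m (m + x) e^{πiτ(m+x)²} = (-iτ)^{-1/2} τ⁻¹ (2πi)⁻¹ ϑ′(x, -1/τ)`;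
* `thetaChi_smul_eq_tsum` — for `γ = (a b; c d)`, `c > 0`, `4 ∣ c`:
  `Θ′(γz) = -(w/2)(2ic/w)^{-1/2} ∑_k k e^{πik²w/(2c)} G_χ(a, k; c)`, `w = cz + d`, with the
  `χ₋₄`-twisted Gauss sums `G_χ(a, k; c) = ∑_{r mod c} χ₋₄(r) e((ar² + kr)/c)` (`chiGaussSum`);
* the evaluation of `G_χ` for `64 ∣ c`: odd `k` vanish (`8 ∣ c`), `k = 2k'` with `k'` even vanish
  (`16 ∣ c`), and for `k'` odd `G_χ(a, 2k'; c) = ψ(-āk'²) χ₋₄(-āk') H(a; c)` with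
  `H(a; c) = ∑_s χ₋₄(s+1) ψ(as²) = 4 G(a; c/16)` (`hSum_eq`);
* `thetaChi_smul_of_dvd` — `Θ′(γz) = -4 w (2ic/w)^{-1/2} G(a; c/16) χ₋₄(-d) Θ′(z)` for `64 ∣ c`,
  and, comparing with `θ(γz) = (2ic/w)^{-1/2} G(a; c) θ(z)`, `G(a; c) = 4G(a; c/16)`, the mixed law
  `thetaChi_smul_mul_theta` — **`Θ′(γz) θ(z) = -χ₋₄(-d) (cz+d) θ(γz) Θ′(z)`**.

Everything is proved; the only definitions are `chiM4`, `thetaChiTerm`, `thetaChi`, `chiM4Z`,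
`chiGaussSum`, `hSum`.
-/

noncomputable section

open scoped MatrixGroups

open UpperHalfPlane hiding I
open Complex Filter Topology

namespace Literature.NumberTheory.EllipticCurves.ModularForms

/-! ### Definition and convergence -/

/-- `χ₋₄(n) ∈ {0, ±1}` as a complex number. [folklore] -/
def chiM4 (n : ℤ) : ℂ := ((ZMod.χ₄ (n : ZMod 4) : ℤ) : ℂ)

/-- `|χ₋₄(n)| ≤ 1`. [folklore] -/
theorem norm_chiM4_le (n : ℤ) : ‖chiM4 n‖ ≤ 1 := by
  unfold chiM4
  rw [Complex.norm_intCast]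
  have h : (ZMod.χ₄ (n : ZMod 4) : ℤ) = 0 ∨ (ZMod.χ₄ (n : ZMod 4) : ℤ) = 1 ∨
      (ZMod.χ₄ (n : ZMod 4) : ℤ) = -1 := by
    generalize (n : ZMod 4) = x
    fin_cases x <;> decide
  rcases h with h | h | h <;> rw [h] <;> norm_num

/-- `χ₋₄` is `4`-periodic. [folklore] -/
theorem chiM4_add_four_mul (n m : ℤ) : chiM4 (n + 4 * m) = chiM4 n := by
  unfold chiM4
  congr 2
  push_cast
  rw [show (4 : ZMod 4) = 0 from rfl, zero_mul, add_zero]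

/-- The terms `χ₋₄(n) n e(n² z)` of `Θ′`. [folklore] -/
def thetaChiTerm (z : ℍ) (n : ℤ) : ℂ := chiM4 n * n * cexp (2 * Real.pi * I * n ^ 2 * (z : ℂ))

/-- **`Θ′(z) = ∑_{n ∈ ℤ} χ₋₄(n) n e^{2πi n² z}`**, the theta series of weight `3/2` attached to the odd
character `χ₋₄` (Shimura 1973, §2, `θ(z, ψ)` with `ν = 1`); `Θ′ = 2 ∑_{n odd > 0} χ₋₄(n) n q^{n²}
= 2 η(8z)³` by Jacobi's identity. [cite: Shimura1973HalfIntegral, §2] -/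
def thetaChi (z : ℍ) : ℂ := ∑' n : ℤ, thetaChiTerm z n

/-- The terms are dominated by those of Mathlib's `jacobiTheta₂'` at `(0, 2z)`:
`‖χ₋₄(n) n e(n²z)‖ ≤ ‖jacobiTheta₂'_term n 0 (2z)‖ / (2π)`. [folklore] -/
theorem norm_thetaChiTerm_le (z : ℍ) (n : ℤ) :
    ‖thetaChiTerm z n‖ ≤ ‖jacobiTheta₂'_term n 0 (2 * (z : ℂ))‖ / (2 * Real.pi) := by
  have hexp : cexp (2 * Real.pi * I * n * 0 + Real.pi * I * n ^ 2 * (2 * (z : ℂ))) =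
      cexp (2 * Real.pi * I * n ^ 2 * (z : ℂ)) := by
    congr 1; ring
  have hE : ‖jacobiTheta₂'_term n 0 (2 * (z : ℂ))‖ =
      2 * Real.pi * (‖(n : ℂ)‖ * ‖cexp (2 * Real.pi * I * n ^ 2 * (z : ℂ))‖) := by
    rw [jacobiTheta₂'_term, jacobiTheta₂_term, hexp]
    simp only [norm_mul, Complex.norm_ofNat, Complex.norm_real, Real.norm_of_nonneg Real.pi_pos.le,
      Complex.norm_I, mul_one]
    ring
  rw [hE, mul_div_cancel_left₀ _ (by positivity : (2 * Real.pi : ℝ) ≠ 0),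
    thetaChiTerm, norm_mul, norm_mul]
  calc ‖chiM4 n‖ * ‖(n : ℂ)‖ * ‖cexp (2 * Real.pi * I * n ^ 2 * (z : ℂ))‖
      = ‖chiM4 n‖ * (‖(n : ℂ)‖ * ‖cexp (2 * Real.pi * I * n ^ 2 * (z : ℂ))‖) := by ring
    _ ≤ 1 * (‖(n : ℂ)‖ * ‖cexp (2 * Real.pi * I * n ^ 2 * (z : ℂ))‖) :=
        mul_le_mul_of_nonneg_right (norm_chiM4_le n) (by positivity)
    _ = _ := one_mul _

/-- `Θ′` converges absolutely. [folklore] -/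
theorem summable_thetaChiTerm (z : ℍ) : Summable (thetaChiTerm z) := by
  have h2 : 0 < (2 * (z : ℂ)).im := by simpa using z.im_pos
  refine Summable.of_norm_bounded (g := fun n ↦ ‖jacobiTheta₂'_term n 0 (2 * (z : ℂ))‖ / (2 * Real.pi))
    ?_ (norm_thetaChiTerm_le z)
  exact (((summable_jacobiTheta₂'_term_iff 0 _).mpr h2).norm.div_const _)

/-- `Θ′` as a `HasSum`. [folklore] -/
theorem hasSum_thetaChi (z : ℍ) : HasSum (thetaChiTerm z) (thetaChi z) :=
  (summable_thetaChiTerm z).hasSum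

/-! ### Poisson summation with a linear factor -/

/-- The terms `(m + x) e^{πiτ(m+x)²}` in terms of Mathlib's theta terms at `(xτ, τ)`. [folklore] -/
theorem linear_mul_cexp_sq_eq (τ x : ℂ) (m : ℤ) :
    (m + x) * cexp (Real.pi * I * τ * (m + x) ^ 2) =
      cexp (Real.pi * I * τ * x ^ 2) *
        (1 / (2 * Real.pi * I) * jacobiTheta₂'_term m (x * τ) τ + x * jacobiTheta₂_term m (x * τ) τ) := by
  have hπ : (2 * Real.pi * I : ℂ) ≠ 0 := by
    simp [Real.pi_ne_zero, I_ne_zero]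
  rw [jacobiTheta₂'_term, jacobiTheta₂_term]
  have he : cexp (Real.pi * I * τ * (m + x) ^ 2) =
      cexp (Real.pi * I * τ * x ^ 2) * cexp (2 * Real.pi * I * m * (x * τ) + Real.pi * I * m ^ 2 * τ) := by
    rw [← Complex.exp_add]; congr 1; ring
  rw [he]
  field_simp

/-- **Poisson summation for `∑ (m + x) e^{πiτ(m+x)²}`**: for `Im τ > 0`,
`∑_{m ∈ ℤ} (m + x) exp(πi τ (m + x)²) = (-iτ)^{-1/2} τ⁻¹ (2πi)⁻¹ ϑ′(x, -1/τ)`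
(`ϑ′ = jacobiTheta₂'`; from the functional equations of `ϑ` and `ϑ′`, the `x ϑ` terms cancel).
[folklore] -/
theorem hasSum_linear_mul_cexp_sq_add {τ : ℂ} (hτ : 0 < τ.im) (x : ℂ) :
    HasSum (fun m : ℤ ↦ (m + x) * cexp (Real.pi * I * τ * (m + x) ^ 2))
      (1 / (-I * τ) ^ (1 / 2 : ℂ) * τ⁻¹ * (1 / (2 * Real.pi * I)) * jacobiTheta₂' x (-1 / τ)) := by
  have hτ0 : τ ≠ 0 := by rintro rfl; simp at hτ
  have hπ : (2 * Real.pi * I : ℂ) ≠ 0 := by simp [Real.pi_ne_zero, I_ne_zero]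
  have h1 := (hasSum_jacobiTheta₂'_term (x * τ) hτ).mul_left (1 / (2 * Real.pi * I))
  have h2 := (hasSum_jacobiTheta₂_term (x * τ) hτ).mul_left x
  have h := (h1.add h2).mul_left (cexp (Real.pi * I * τ * x ^ 2))
  simp_rw [← linear_mul_cexp_sq_eq] at h
  -- the value: functional equations
  have hv : cexp (Real.pi * I * τ * x ^ 2) *
      (1 / (2 * Real.pi * I) * jacobiTheta₂' (x * τ) τ + x * jacobiTheta₂ (x * τ) τ) =
      1 / (-I * τ) ^ (1 / 2 : ℂ) * τ⁻¹ * (1 / (2 * Real.pi * I)) * jacobiTheta₂' x (-1 / τ) := by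
    rw [jacobiTheta₂'_functional_equation (x * τ) τ, jacobiTheta₂_functional_equation (x * τ) τ,
      mul_div_cancel_right₀ x hτ0]
    have e2 : -Real.pi * I * (x * τ) ^ 2 / τ = -(Real.pi * I * τ * x ^ 2) := by field_simp
    rw [e2, Complex.exp_neg]
    have hA : cexp (Real.pi * I * τ * x ^ 2) ≠ 0 := Complex.exp_ne_zero _
    field_simp
    ring
  rw [hv] at h
  exact h

/-! ### The `χ₋₄`-twisted Gauss sums and the transformation law for `4 ∣ c` -/

section Transform

variable {c : ℕ} [NeZero c]

/-- `χ₋₄(r)` for a residue `r` modulo `c`, `4 ∣ c`. [folklore] -/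
def chiM4Z (h4 : 4 ∣ c) (r : ZMod c) : ℂ := ((ZMod.χ₄ (ZMod.castHom h4 (ZMod 4) r) : ℤ) : ℂ)

omit [NeZero c] in
/-- `chiM4Z` on an integer is `χ₋₄`. [folklore] -/
theorem chiM4Z_intCast (h4 : 4 ∣ c) (n : ℤ) : chiM4Z h4 (n : ZMod c) = chiM4 n := by
  unfold chiM4Z chiM4
  rw [map_intCast]

/-- `|chiM4Z| ≤ 1`. [folklore] -/
theorem norm_chiM4Z_le (h4 : 4 ∣ c) (r : ZMod c) : ‖chiM4Z h4 r‖ ≤ 1 := by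
  have : chiM4Z h4 r = chiM4 ((r.val : ℕ) : ℤ) := by
    rw [← chiM4Z_intCast h4, Int.cast_natCast, ZMod.natCast_zmod_val]
  rw [this]
  exact norm_chiM4_le _

/-- **The `χ₋₄`-twisted quadratic Gauss sum** `G_χ(a, k; c) = ∑_{r mod c} χ₋₄(r) e((a r² + k r)/c)`
(`4 ∣ c`). [folklore] -/
def chiGaussSum (h4 : 4 ∣ c) (a k : ZMod c) : ℂ :=
  ∑ r : ZMod c, chiM4Z h4 r * (ZMod.stdAddChar (a * r ^ 2 + k * r) : ℂ)

/-- `|G_χ(a, k; c)| ≤ c`. [folklore] -/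
theorem norm_chiGaussSum_le (h4 : 4 ∣ c) (a k : ZMod c) : ‖chiGaussSum h4 a k‖ ≤ c := by
  unfold chiGaussSum
  refine (norm_sum_le _ _).trans ?_
  have : ∀ r : ZMod c, ‖chiM4Z h4 r * (ZMod.stdAddChar (a * r ^ 2 + k * r) : ℂ)‖ ≤ 1 := fun r ↦ by
    rw [norm_mul, AddChar.norm_apply, mul_one]
    exact norm_chiM4Z_le h4 r
  calc ∑ r : ZMod c, ‖chiM4Z h4 r * (ZMod.stdAddChar (a * r ^ 2 + k * r) : ℂ)‖
      ≤ ∑ _r : ZMod c, (1 : ℝ) := Finset.sum_le_sum fun r _ ↦ this r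
    _ = c := by simp

/-- `G_χ` as a sum over the representatives `0 ≤ r < c`. [folklore] -/
theorem chiGaussSum_eq_sum_range (h4 : 4 ∣ c) (a k : ℤ) :
    chiGaussSum h4 a k = ∑ r ∈ Finset.range c,
      chiM4 r * cexp (2 * Real.pi * I * ((a * r ^ 2 + k * r : ℤ) : ℂ) / c) := by
  rw [chiGaussSum, Literature.NumberTheory.LFunctions.sum_zmod_eq_sum_range]
  refine Finset.sum_congr rfl fun r _ ↦ ?_
  have : ((a : ZMod c) * (r : ZMod c) ^ 2 + (k : ZMod c) * (r : ZMod c)) =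
      ((a * r ^ 2 + k * r : ℤ) : ZMod c) := by push_cast; ring
  rw [this, ZMod.stdAddChar_coe, ← Int.cast_natCast, chiM4Z_intCast]

/-- The terms of the transformed series are bounded by those of `ϑ′` at `(0, w/(2c))`:
`‖k e^{πik²w/(2c)} G_χ‖ ≤ (c/(2π)) ‖jacobiTheta₂'_term k 0 (w/(2c))‖`. [folklore] -/
theorem norm_thetaChiTransform_le (h4 : 4 ∣ c) (a : ZMod c) (w : ℂ) (k : ℤ) :
    ‖(k : ℂ) * cexp (Real.pi * I * k ^ 2 * (w / (2 * c))) * chiGaussSum h4 a k‖ ≤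
      c / (2 * Real.pi) * ‖jacobiTheta₂'_term k 0 (w / (2 * c))‖ := by
  have hE : ‖jacobiTheta₂'_term k 0 (w / (2 * c))‖ =
      2 * Real.pi * (‖(k : ℂ)‖ * ‖cexp (Real.pi * I * k ^ 2 * (w / (2 * c)))‖) := by
    rw [jacobiTheta₂'_term, jacobiTheta₂_term, mul_zero, zero_add]
    simp only [norm_mul, Complex.norm_ofNat, Complex.norm_real, Real.norm_of_nonneg Real.pi_pos.le,
      Complex.norm_I, mul_one]
    ring
  rw [hE, norm_mul, norm_mul]
  have hG := norm_chiGaussSum_le h4 a k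
  have h0 : 0 ≤ ‖(k : ℂ)‖ * ‖cexp (Real.pi * I * k ^ 2 * (w / (2 * c)))‖ := by positivity
  calc ‖(k : ℂ)‖ * ‖cexp (Real.pi * I * k ^ 2 * (w / (2 * c)))‖ * ‖chiGaussSum h4 a k‖
      ≤ ‖(k : ℂ)‖ * ‖cexp (Real.pi * I * k ^ 2 * (w / (2 * c)))‖ * c :=
        mul_le_mul_of_nonneg_left hG h0
    _ = c / (2 * Real.pi) * (2 * Real.pi * (‖(k : ℂ)‖ * ‖cexp (Real.pi * I * k ^ 2 * (w / (2 * c)))‖)) := by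
        field_simp

/-- The transformed series converges absolutely (`Im w > 0`). [folklore] -/
theorem summable_thetaChiTransform (h4 : 4 ∣ c) (a : ZMod c) {w : ℂ} (hw : 0 < w.im) :
    Summable (fun k : ℤ ↦ (k : ℂ) * cexp (Real.pi * I * k ^ 2 * (w / (2 * c))) * chiGaussSum h4 a k) := by
  have hw' : 0 < (w / (2 * c)).im := im_div_two_mul_pos hw
  refine Summable.of_norm_bounded (g := fun k : ℤ ↦ c / (2 * Real.pi) * ‖jacobiTheta₂'_term k 0 (w / (2 * c))‖)
    (((summable_jacobiTheta₂'_term_iff 0 _).mpr hw').norm.mul_left _) (norm_thetaChiTransform_le h4 a w)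

/-- **The transformation law of `Θ′` under `(a b; c d)` with `c > 0`, `4 ∣ c`** (Poisson summation on
the classes modulo `c`, with the linear factor):
`Θ′(γz) = -(w/2) (2ic/w)^{-1/2} ∑_{k ∈ ℤ} k exp(πi k² w/(2c)) G_χ(a, k; c)`, `w = cz + d`.
[cite: Shimura1973HalfIntegral, §2] -/
theorem thetaChi_smul_eq_tsum {γ : SL(2, ℤ)} (hc : (γ 1 0 : ℤ) = c) (h4 : 4 ∣ c) (z : ℍ) :
    thetaChi (γ • z) =
      -(((c : ℂ) * z + γ 1 1) / 2) * (1 / (2 * I * c / ((c : ℂ) * z + γ 1 1)) ^ (1 / 2 : ℂ)) *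
        ∑' k : ℤ, (k : ℂ) * cexp (Real.pi * I * k ^ 2 * (((c : ℂ) * z + γ 1 1) / (2 * c))) *
          chiGaussSum h4 (γ 0 0) k := by
  -- notation
  set a : ℤ := γ 0 0 with ha
  set b : ℤ := γ 0 1 with hb
  set d : ℤ := γ 1 1 with hd
  set w : ℂ := (c : ℂ) * z + d with hw
  have hc0 : (c : ℂ) ≠ 0 := Nat.cast_ne_zero.mpr (NeZero.ne c)
  have hcR : (0 : ℝ) < c := Nat.cast_pos.mpr (Nat.pos_of_ne_zero (NeZero.ne c))
  have hw_im : 0 < w.im := im_denom_pos d z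
  have hw0 : w ≠ 0 := by rintro h; rw [h] at hw_im; simp at hw_im
  have hdet : (a : ℂ) * d - b * c = 1 := by
    have := det_eq_one' γ
    rw [hc] at this
    exact_mod_cast this
  -- `τ = -2c/w ∈ ℍ`
  set τ : ℂ := -2 * c / w with hτ
  have hτ_im : 0 < τ.im := by
    rw [hτ, show -2 * (c : ℂ) / w = ((-2 * c : ℝ) : ℂ) * w⁻¹ by push_cast; ring, Complex.mul_im]
    simp only [ofReal_re, ofReal_im, zero_mul, add_zero, inv_im]
    have : 0 < Complex.normSq w := Complex.normSq_pos.mpr hw0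
    have : (-2 * (c : ℝ)) * (-w.im / Complex.normSq w) = 2 * c * (w.im / Complex.normSq w) := by ring
    rw [this]
    positivity
  have hτ0 : τ ≠ 0 := by rintro h; rw [h] at hτ_im; simp at hτ_im
  have hIτ : -I * τ = 2 * I * c / w := by rw [hτ]; field_simp
  have hinvτ : -1 / τ = w / (2 * c) := by rw [hτ]; field_simp
  have hinvτ' : τ⁻¹ = -(w / (2 * c)) := by rw [hτ]; field_simp
  -- the coordinate of `γ • z`
  have hγz : ((γ • z : ℍ) : ℂ) = a / c - 1 / (c * w) := by
    rw [coe_smul_eq', ← ha, ← hb, ← hd, hc]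
    push_cast
    rw [moebius_eq_sub_inv' hc0 hdet hw0]
  -- exponentials on the class `n = m c + r`
  have hexp : ∀ (m : ℤ) (r : ℕ),
      cexp (2 * Real.pi * I * ((m * c + r : ℤ) : ℂ) ^ 2 * ((γ • z : ℍ) : ℂ)) =
        cexp (2 * Real.pi * I * ((a * r ^ 2 : ℤ) : ℂ) / c) *
          cexp (Real.pi * I * τ * (m + (r : ℂ) / c) ^ 2) := by
    intro m r
    rw [← Complex.exp_add, hγz]
    refine cexp_eq_cexp_of_sub_eq (a * (m ^ 2 * c + 2 * m * r)) ?_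
    rw [hτ]
    push_cast
    field_simp
    ring
  -- the character is constant on the class (`4 ∣ c`)
  have hchi : ∀ (m : ℤ) (r : ℕ), chiM4 (m * c + r) = chiM4 r := by
    intro m r
    obtain ⟨q, hq⟩ := h4
    rw [show (m * c + r : ℤ) = r + 4 * (m * q) by rw [hq]; push_cast; ring]
    exact chiM4_add_four_mul _ _
  -- the terms of `Θ′(γz)` on the class
  have hterm : ∀ (m : ℤ) (r : ℕ), thetaChiTerm (γ • z) (m * c + r) =
      chiM4 r * (c : ℂ) * cexp (2 * Real.pi * I * ((a * r ^ 2 : ℤ) : ℂ) / c) *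
        ((m + (r : ℂ) / c) * cexp (Real.pi * I * τ * (m + (r : ℂ) / c) ^ 2)) := by
    intro m r
    rw [thetaChiTerm, hchi, hexp]
    push_cast
    field_simp
  -- Poisson summation on each class
  have hfib : ∀ r : Fin c, HasSum (fun m : ℤ ↦ thetaChiTerm (γ • z) (m * c + (r : ℕ)))
      (chiM4 (r : ℕ) * (c : ℂ) * cexp (2 * Real.pi * I * ((a * (r : ℕ) ^ 2 : ℤ) : ℂ) / c) *
        (1 / (-I * τ) ^ (1 / 2 : ℂ) * τ⁻¹ * (1 / (2 * Real.pi * I)) *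
          jacobiTheta₂' ((r : ℕ) / c) (-1 / τ))) := by
    intro r
    simp_rw [hterm]
    exact (hasSum_linear_mul_cexp_sq_add hτ_im _).mul_left _
  -- reindex `ℤ` by `Fin c × ℤ`
  have htot := hasSum_thetaChi (γ • z)
  let e : Fin c × ℤ ≃ ℤ := (Equiv.prodComm _ _).trans (Int.divModEquiv c).symm
  have he : ∀ p : Fin c × ℤ, e p = p.2 * c + (p.1 : ℕ) := fun p ↦ rfl
  rw [← e.hasSum_iff] at htot
  have htot' : HasSum (fun p : Fin c × ℤ ↦ thetaChiTerm (γ • z) (p.2 * c + (p.1 : ℕ)))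
      (thetaChi (γ • z)) := by
    convert htot using 2 with p
    rw [Function.comp_apply, he]
  have hsum := htot'.prod_fiberwise hfib
  rw [← (hasSum_fintype _).unique hsum]
  -- swap the finite sum over `r` with the series over `k`
  simp_rw [hIτ, hinvτ, hinvτ']
  have hw2 : 0 < (w / (2 * c)).im := im_div_two_mul_pos hw_im
  have hk : ∀ r : Fin c, HasSum (fun k : ℤ ↦
      chiM4 (r : ℕ) * (c : ℂ) * cexp (2 * Real.pi * I * ((a * (r : ℕ) ^ 2 : ℤ) : ℂ) / c) *
        (1 / (2 * I * c / w) ^ (1 / 2 : ℂ) * -(w / (2 * c)) * (1 / (2 * Real.pi * I)) *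
          jacobiTheta₂'_term k ((r : ℕ) / c) (w / (2 * c))))
      (chiM4 (r : ℕ) * (c : ℂ) * cexp (2 * Real.pi * I * ((a * (r : ℕ) ^ 2 : ℤ) : ℂ) / c) *
        (1 / (2 * I * c / w) ^ (1 / 2 : ℂ) * -(w / (2 * c)) * (1 / (2 * Real.pi * I)) *
          jacobiTheta₂' ((r : ℕ) / c) (w / (2 * c)))) := by
    intro r
    exact ((hasSum_jacobiTheta₂'_term _ hw2).mul_left _).mul_left _
  have hK := hasSum_sum (s := (Finset.univ : Finset (Fin c))) fun r _ ↦ hk r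
  rw [← hK.tsum_eq, ← tsum_mul_left]
  refine tsum_congr fun k ↦ ?_
  rw [chiGaussSum_eq_sum_range, ← Fin.sum_univ_eq_sum_range, Finset.mul_sum, Finset.mul_sum]
  refine Finset.sum_congr rfl fun r _ ↦ ?_
  rw [jacobiTheta₂'_term, jacobiTheta₂_term]
  have hπ : (2 * Real.pi * I : ℂ) ≠ 0 := by simp [Real.pi_ne_zero, I_ne_zero]
  have this : cexp (2 * Real.pi * I * ((a * (r : ℕ) ^ 2 : ℤ) : ℂ) / c) *
      cexp (2 * Real.pi * I * k * ((r : ℕ) / c) + Real.pi * I * k ^ 2 * (w / (2 * c))) =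
      cexp (Real.pi * I * k ^ 2 * (w / (2 * c))) *
        cexp (2 * Real.pi * I * ((a * (r : ℕ) ^ 2 + k * (r : ℕ) : ℤ) : ℂ) / c) := by
    rw [← Complex.exp_add, ← Complex.exp_add]
    congr 1
    push_cast
    ring
  set Ea := cexp (2 * Real.pi * I * ((a * (r : ℕ) ^ 2 : ℤ) : ℂ) / c) with hEa
  set Ek := cexp (2 * Real.pi * I * k * ((r : ℕ) / c) + Real.pi * I * k ^ 2 * (w / (2 * c))) with hEk
  set Ew := cexp (Real.pi * I * k ^ 2 * (w / (2 * c))) with hEw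
  set Eak := cexp (2 * Real.pi * I * ((a * (r : ℕ) ^ 2 + k * (r : ℕ) : ℤ) : ℂ) / c) with hEak
  set X := (1 / (2 * I * c / w) ^ (1 / 2 : ℂ)) with hX
  calc chiM4 (r : ℕ) * (c : ℂ) * Ea * (X * -(w / (2 * c)) * (1 / (2 * Real.pi * I)) * (2 * Real.pi * I * k * Ek))
      = chiM4 (r : ℕ) * (c : ℂ) * X * (-(w / (2 * c))) * ((1 / (2 * Real.pi * I)) * (2 * Real.pi * I))
          * k * (Ea * Ek) := by ring
    _ = chiM4 (r : ℕ) * (c : ℂ) * X * (-(w / (2 * c))) * 1 * k * (Ew * Eak) := by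
          rw [this, one_div_mul_cancel hπ]
    _ = -(w / 2) * X * (k * Ew * (chiM4 (r : ℕ) * Eak)) := by
          field_simp

end Transform

/-! ### Evaluation of the `χ₋₄`-twisted Gauss sums -/

section GaussLemmas

variable {c : ℕ} [NeZero c]

/-- `χ₋₄` vanishes or the residue is odd: if `chiM4Z r ≠ 0` then `r = 2 s + 1`. [folklore] -/
theorem exists_eq_two_mul_add_one_of_chiM4Z_ne_zero (h4 : 4 ∣ c) {r : ZMod c} (hr : chiM4Z h4 r ≠ 0) :
    ∃ s : ZMod c, r = 2 * s + 1 := by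
  have h2 : 2 ∣ c := dvd_trans (by norm_num) h4
  have hodd : r.val % 2 = 1 := by
    by_contra heven
    have heven' : r.val % 2 = 0 := by omega
    apply hr
    have hr4 : (ZMod.castHom h4 (ZMod 4) r) = ((r.val : ℕ) : ZMod 4) := by
      rw [← map_natCast (ZMod.castHom h4 (ZMod 4)), ZMod.natCast_zmod_val]
    unfold chiM4Z
    rw [hr4]
    have : ((r.val : ℕ) : ZMod 4) = 0 ∨ ((r.val : ℕ) : ZMod 4) = 2 := by
      have h := Nat.mod_add_div r.val 4
      have hm : r.val % 4 = 0 ∨ r.val % 4 = 2 := by omega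
      rcases hm with hm | hm
      · left; rw [← ZMod.natCast_mod r.val 4, hm]; rfl
      · right; rw [← ZMod.natCast_mod r.val 4, hm]; rfl
    rcases this with h0 | h0
    · rw [h0, show ZMod.χ₄ (0 : ZMod 4) = 0 by decide, Int.cast_zero]
    · rw [h0, show ZMod.χ₄ (2 : ZMod 4) = 0 by decide, Int.cast_zero]
  refine ⟨((r.val / 2 : ℕ) : ZMod c), ?_⟩
  have : r.val = 2 * (r.val / 2) + 1 := by omega
  calc r = ((r.val : ℕ) : ZMod c) := (ZMod.natCast_zmod_val r).symm
    _ = 2 * ((r.val / 2 : ℕ) : ZMod c) + 1 := by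
        conv_lhs => rw [this]
        push_cast
        ring

omit [NeZero c] in
/-- `χ₋₄(r + h) = χ₋₄(r)` when `h ≡ 0 (mod 4)`: the class `c/2` for `8 ∣ c`. [folklore] -/
theorem chiM4Z_add_half (h8 : 8 ∣ c) (h4 : 4 ∣ c) (r : ZMod c) :
    chiM4Z h4 (r + ((c / 2 : ℕ) : ZMod c)) = chiM4Z h4 r := by
  unfold chiM4Z
  rw [map_add, map_natCast]
  obtain ⟨q, hq⟩ := h8
  have : ((c / 2 : ℕ) : ZMod 4) = 0 := by
    rw [hq, show 8 * q / 2 = 4 * q by omega]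
    push_cast
    rw [show (4 : ZMod 4) = 0 from rfl, zero_mul]
  rw [this, add_zero]

omit [NeZero c] in
/-- The class `c/4` for `16 ∣ c` is `≡ 0 (mod 4)`. [folklore] -/
theorem chiM4Z_add_quarter (h16 : 16 ∣ c) (h4 : 4 ∣ c) (r : ZMod c) :
    chiM4Z h4 (r + ((c / 4 : ℕ) : ZMod c)) = chiM4Z h4 r := by
  unfold chiM4Z
  rw [map_add, map_natCast]
  obtain ⟨q, hq⟩ := h16
  have : ((c / 4 : ℕ) : ZMod 4) = 0 := by
    rw [hq, show 16 * q / 4 = 4 * (q) by omega]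
    push_cast
    rw [show (4 : ZMod 4) = 0 from rfl, zero_mul]
  rw [this, add_zero]

omit [NeZero c] in
/-- `2 (c/4) = c/2` and `(c/4)² = 0` in `ℤ/c` for `16 ∣ c`. [folklore] -/
theorem quarter_facts (h16 : 16 ∣ c) :
    (2 : ZMod c) * ((c / 4 : ℕ) : ZMod c) = ((c / 2 : ℕ) : ZMod c) ∧
    (((c / 4 : ℕ) : ZMod c)) ^ 2 = 0 := by
  obtain ⟨q, hq⟩ := h16
  constructor
  · have : 2 * (c / 4) = c / 2 := by omega
    exact_mod_cast congrArg (fun n : ℕ ↦ (n : ZMod c)) this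
  · have h1 : (c / 4) ^ 2 = c * q := by
      rw [hq, show 16 * q / 4 = 4 * q by omega]; ring
    have h := congrArg (fun n : ℕ ↦ (n : ZMod c)) h1
    simp only [Nat.cast_pow, Nat.cast_mul, ZMod.natCast_self, zero_mul] at h
    exact h

/-- **(i) `G_χ(a, k; c) = 0` for `8 ∣ c` and `k` odd** (shift `r ↦ r + c/2`: the character is
unchanged, the phase gains `e(1/2) = -1`). [folklore] -/
theorem chiGaussSum_eq_zero_of_odd (h8 : 8 ∣ c) (h4 : 4 ∣ c) (a : ZMod c) {k : ℤ} (hk : Odd k) :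
    chiGaussSum h4 a k = 0 := by
  set h : ZMod c := ((c / 2 : ℕ) : ZMod c) with hh
  have h2 : 2 ∣ c := dvd_trans (by norm_num) h4
  have hkh : (k : ZMod c) * h = h := by
    obtain ⟨j, rfl⟩ := hk
    push_cast
    linear_combination (j : ZMod c) * two_mul_half h2
  have hsq : h ^ 2 = 0 := half_sq_of_four_dvd h4
  have key : chiGaussSum h4 a k = -chiGaussSum h4 a k := by
    unfold chiGaussSum
    conv_lhs => rw [← Equiv.sum_comp (Equiv.addRight h)]
    rw [← neg_one_mul, Finset.mul_sum]
    refine Finset.sum_congr rfl fun r _ ↦ ?_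
    simp only [Equiv.coe_addRight]
    rw [chiM4Z_add_half h8 h4]
    have : a * (r + h) ^ 2 + (k : ZMod c) * (r + h) = (a * r ^ 2 + (k : ZMod c) * r) + h := by
      linear_combination a * hsq + (a * r) * two_mul_half h2 + hkh
    rw [this, AddChar.map_add_eq_mul, stdAddChar_half h2]
    ring
  have : (2 : ℂ) * chiGaussSum h4 a k = 0 := by linear_combination key
  simpa using this

/-- **(ii) `G_χ(a, 2k'; c) = 0` for `16 ∣ c`, `a` odd and `k'` even** (shift `r ↦ r + c/4`: on odd `r`,
where `χ₋₄ ≠ 0`, the phase gains `e(a r (c/2)/c) = -1`). [folklore] -/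
theorem chiGaussSum_eq_zero_of_even (h16 : 16 ∣ c) (h4 : 4 ∣ c) {a : ℤ} (ha : Odd a) {k' : ℤ}
    (hk : Even k') : chiGaussSum h4 a (2 * k') = 0 := by
  have h8 : 8 ∣ c := dvd_trans (by norm_num) h16
  have h2 : 2 ∣ c := dvd_trans (by norm_num) h4
  set q4 : ZMod c := ((c / 4 : ℕ) : ZMod c) with hq4
  set h : ZMod c := ((c / 2 : ℕ) : ZMod c) with hh
  obtain ⟨h2q, hq4sq⟩ := quarter_facts h16
  have hkq : 2 * (k' : ZMod c) * q4 = 0 := by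
    obtain ⟨j, rfl⟩ := hk
    push_cast
    rw [show (2 : ZMod c) * (j + j) * q4 = j * (2 * (2 * q4)) by ring, h2q, two_mul_half h2, mul_zero]
  have key : chiGaussSum h4 a (2 * k') = -chiGaussSum h4 a (2 * k') := by
    unfold chiGaussSum
    conv_lhs => rw [← Equiv.sum_comp (Equiv.addRight q4)]
    rw [← neg_one_mul, Finset.mul_sum]
    refine Finset.sum_congr rfl fun r _ ↦ ?_
    simp only [Equiv.coe_addRight]
    rw [chiM4Z_add_quarter h16 h4]
    by_cases hr : chiM4Z h4 r = 0
    · rw [hr]; simp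
    · obtain ⟨s, hs⟩ := exists_eq_two_mul_add_one_of_chiM4Z_ne_zero h4 hr
      -- `a r (2 q4) = a r h = h` for `r` odd and `a` odd
      have harh : (a : ZMod c) * r * (2 * q4) = h := by
        rw [h2q, hs]
        obtain ⟨j, rfl⟩ := ha
        push_cast
        linear_combination ((2 * j + 1) * s + j : ZMod c) * two_mul_half h2
      have : (a : ZMod c) * (r + q4) ^ 2 + 2 * (k' : ZMod c) * (r + q4) =
          ((a : ZMod c) * r ^ 2 + 2 * (k' : ZMod c) * r) + h := by
        linear_combination (a : ZMod c) * hq4sq + harh + hkq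
      rw [this, AddChar.map_add_eq_mul, stdAddChar_half h2]
      ring
  have : (2 : ℂ) * chiGaussSum h4 a (2 * k') = 0 := by linear_combination key
  simpa using this

/-- `χ₋₄(s - u) = χ₋₄(-u) χ₋₄(s + 1)` for odd `u` (both sides vanish for odd `s`). [folklore] -/
theorem chiM4_sub_odd (s u : ZMod 4) (hu : u = 1 ∨ u = 3) :
    ZMod.χ₄ (s - u) = ZMod.χ₄ (-u) * ZMod.χ₄ (s + 1) := by
  rcases hu with rfl | rfl <;> fin_cases s <;> decide

/-- The weight `[s ≡ 0 (4)] - [s ≡ 2 (4)] = χ₋₄(s + 1)` sum: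
`H(a; c) = ∑_{s mod c} χ₋₄(s + 1) ψ(a s²)`. [folklore] -/
def hSum (h4 : 4 ∣ c) (a : ZMod c) : ℂ := ∑ s : ZMod c, chiM4Z h4 (s + 1) * (ZMod.stdAddChar (a * s ^ 2) : ℂ)

/-- **(iii) Completing the square**: for `a ā = 1` in `ℤ/c`, `ā k'` odd,
`G_χ(a, 2k'; c) = ψ(-ā k'²) χ₋₄(-ā k') H(a; c)`. [folklore] -/
theorem chiGaussSum_two_mul_of_odd (h4 : 4 ∣ c) {a abar : ZMod c} (haa : a * abar = 1) {k' : ℤ}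
    (hu : ZMod.castHom h4 (ZMod 4) (abar * k') = 1 ∨ ZMod.castHom h4 (ZMod 4) (abar * k') = 3) :
    chiGaussSum h4 a (2 * k') =
      (ZMod.stdAddChar (-(abar * (k' : ZMod c) ^ 2)) : ℂ) *
        ((ZMod.χ₄ (-(ZMod.castHom h4 (ZMod 4) (abar * k'))) : ℤ) : ℂ) * hSum h4 a := by
  set u : ZMod c := abar * k' with hu'
  unfold chiGaussSum hSum
  -- complete the square
  have hcs : ∀ r : ZMod c, a * r ^ 2 + 2 * (k' : ZMod c) * r =
      a * (r + u) ^ 2 + -(abar * (k' : ZMod c) ^ 2) := by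
    intro r
    rw [hu']
    linear_combination (-(2 * r * (k' : ZMod c)) - abar * (k' : ZMod c) ^ 2) * haa
  have hstep : ∀ r : ZMod c, chiM4Z h4 r * (ZMod.stdAddChar (a * r ^ 2 + 2 * (k' : ZMod c) * r) : ℂ) =
      (ZMod.stdAddChar (-(abar * (k' : ZMod c) ^ 2)) : ℂ) *
        (chiM4Z h4 r * (ZMod.stdAddChar (a * (r + u) ^ 2) : ℂ)) := by
    intro r
    rw [hcs, AddChar.map_add_eq_mul]
    ring
  rw [Finset.sum_congr rfl (fun r _ ↦ hstep r), ← Finset.mul_sum, mul_assoc]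
  congr 1
  -- substitute `s = r + u`
  rw [← (Equiv.subRight u).sum_comp (fun r ↦ chiM4Z h4 r * (ZMod.stdAddChar (a * (r + u) ^ 2) : ℂ))]
  simp only [Equiv.subRight_apply, sub_add_cancel]
  rw [Finset.mul_sum]
  refine Finset.sum_congr rfl fun s _ ↦ ?_
  have hchi : chiM4Z h4 (s - u) =
      ((ZMod.χ₄ (-(ZMod.castHom h4 (ZMod 4) u)) : ℤ) : ℂ) * chiM4Z h4 (s + 1) := by
    unfold chiM4Z
    rw [map_sub, (ZMod.castHom h4 (ZMod 4)).map_add, map_one, chiM4_sub_odd _ _ hu, Int.cast_mul]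
  rw [hchi]
  ring

end GaussLemmas

/-! ### (iv) `H(a; c) = 4 G(a; c/16)` for `64 ∣ c` -/

section HSum

variable {c : ℕ} [NeZero c]

open Literature.NumberTheory.LFunctions (sum_zmod_eq_sum_range sum_range_mul_eq_sum_sum)

/-- `H(a; c)` as a sum over representatives. [folklore] -/
theorem hSum_eq_sum_range (h4 : 4 ∣ c) (a : ℤ) :
    hSum h4 a = ∑ n ∈ Finset.range c, chiM4 (n + 1) * cexp (2 * Real.pi * I * ((a * n ^ 2 : ℤ) : ℂ) / c) := by
  rw [hSum, sum_zmod_eq_sum_range]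
  refine Finset.sum_congr rfl fun n _ ↦ ?_
  have e1 : ((n : ZMod c) + 1) = ((n + 1 : ℤ) : ZMod c) := by push_cast; ring
  have e2 : ((a : ZMod c) * (n : ZMod c) ^ 2) = ((a * n ^ 2 : ℤ) : ZMod c) := by push_cast; ring
  rw [e1, chiM4Z_intCast, e2, ZMod.stdAddChar_coe]

/-- A `c₂`-periodic summand summed over `4c₂` consecutive values. [folklore] -/
theorem sum_range_four_mul_of_periodic (c₂ : ℕ) (F : ℕ → ℂ) (hF : ∀ u j, F (u + c₂ * j) = F u) :
    ∑ n ∈ Finset.range (c₂ * 4), F n = 4 * ∑ u ∈ Finset.range c₂, F u := by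
  rw [sum_range_mul_eq_sum_sum c₂ 4 F, Finset.mul_sum]
  refine Finset.sum_congr rfl fun u _ ↦ ?_
  simp_rw [hF]
  simp [Finset.sum_const, Finset.card_range]

/-- **`H(a; c) = 4 G(a; c/16)`** for `64 ∣ c` and `a` odd: in `H = ∑_{m<c/4} e(a(4m)²/c) -
∑_{m<c/4} e(a(4m+2)²/c)` the first sum is `4 G(a; c/16)` and the second is
`4 e(a/(c/4)) G(a, a; c/16) = 0`. [folklore] -/
theorem hSum_eq (h64 : 64 ∣ c) (h4 : 4 ∣ c) {a : ℤ} (ha : Odd a) (c₂ : ℕ) [NeZero c₂] (hc : c = 16 * c₂) :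
    hSum h4 a = 4 * quadGaussSum c₂ a 0 := by
  have hc₂4 : 4 ∣ c₂ := by obtain ⟨q, hq⟩ := h64; exact ⟨q, by omega⟩
  have hc0 : (c : ℂ) ≠ 0 := Nat.cast_ne_zero.mpr (NeZero.ne c)
  have hc₂0 : (c₂ : ℂ) ≠ 0 := Nat.cast_ne_zero.mpr (NeZero.ne c₂)
  rw [hSum_eq_sum_range]
  -- split `n = u + 4 m`, `u < 4`, `m < c/4 = 4 c₂`
  rw [show Finset.range c = Finset.range (4 * (4 * c₂)) by rw [hc]; ring_nf,
    sum_range_mul_eq_sum_sum 4 (4 * c₂)]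
  simp only [Finset.sum_range_succ, Finset.sum_range_zero, zero_add]
  -- the character values `χ(u + 4m + 1)` for `u = 0, 1, 2, 3`
  have hchi : ∀ (u : ℕ) (m : ℕ), chiM4 (((u + 4 * m : ℕ) : ℤ) + 1) = chiM4 ((u : ℤ) + 1) := by
    intro u m
    rw [show (((u + 4 * m : ℕ) : ℤ) + 1) = ((u : ℤ) + 1) + 4 * (m : ℤ) by push_cast; ring]
    exact chiM4_add_four_mul _ _
  have hchi0 : ∀ m : ℕ, chiM4 (((4 * m : ℕ) : ℤ) + 1) = 1 := by
    intro m
    rw [show (((4 * m : ℕ) : ℤ) + 1) = (1 : ℤ) + 4 * (m : ℤ) by push_cast; ring, chiM4_add_four_mul]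
    unfold chiM4; rw [show ZMod.χ₄ (((1 : ℤ)) : ZMod 4) = 1 by decide]; simp
  simp_rw [hchi]
  have c2 : chiM4 ((1 : ℕ) + 1) = 0 := by
    unfold chiM4; rw [show ZMod.χ₄ (((1 : ℕ) + 1 : ℤ) : ZMod 4) = 0 by decide]; simp
  have c3 : chiM4 ((2 : ℕ) + 1) = -1 := by
    unfold chiM4; rw [show ZMod.χ₄ (((2 : ℕ) + 1 : ℤ) : ZMod 4) = -1 by decide]; simp
  have c4 : chiM4 ((3 : ℕ) + 1) = 0 := by
    unfold chiM4; rw [show ZMod.χ₄ (((3 : ℕ) + 1 : ℤ) : ZMod 4) = 0 by decide]; simp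
  simp only [hchi0, c2, c3, c4, one_mul, zero_mul, Finset.sum_const_zero, add_zero, neg_one_mul,
    Finset.sum_neg_distrib]
  -- first sum: `e(a (4m)²/(16 c₂)) = e(a m²/c₂)`, `c₂`-periodic, `= 4 G(a; c₂)`
  have hA : ∑ m ∈ Finset.range (4 * c₂), cexp (2 * Real.pi * I * ((a * ((4 * m : ℕ) : ℤ) ^ 2 : ℤ) : ℂ) / c) =
      4 * quadGaussSum c₂ a 0 := by
    rw [quadGaussSum_zero_eq_sum_range, mul_comm 4 c₂]
    rw [← sum_range_four_mul_of_periodic c₂ (fun m ↦ cexp (2 * Real.pi * I * ((a * m ^ 2 : ℤ) : ℂ) / c₂))]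
    · refine Finset.sum_congr rfl fun m _ ↦ ?_
      refine cexp_eq_cexp_of_sub_eq 0 ?_
      rw [hc]; push_cast; field_simp; ring
    · intro u j
      refine cexp_eq_cexp_of_sub_eq (a * (2 * u * j + c₂ * j ^ 2)) ?_
      push_cast; field_simp; ring
  -- second sum: `e(a(4m+2)²/(16c₂)) = e(a/(4c₂)) e(a(m² + m)/c₂)`, summing to `4 e(…) G(a, a; c₂) = 0`
  have hB : ∑ m ∈ Finset.range (4 * c₂), cexp (2 * Real.pi * I * ((a * ((2 + 4 * m : ℕ) : ℤ) ^ 2 : ℤ) : ℂ) / c) = 0 := by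
    have hG : quadGaussSum c₂ a a = 0 := quadGaussSum_eq_zero_of_odd hc₂4 a ha
    rw [quadGaussSum_eq_sum_range] at hG
    have : ∑ m ∈ Finset.range (4 * c₂), cexp (2 * Real.pi * I * ((a * ((2 + 4 * m : ℕ) : ℤ) ^ 2 : ℤ) : ℂ) / c) =
        cexp (2 * Real.pi * I * a / (4 * c₂)) * (4 * ∑ m ∈ Finset.range c₂,
          cexp (2 * Real.pi * I * ((a * m ^ 2 + a * m : ℤ) : ℂ) / c₂)) := by
      rw [mul_comm 4 c₂, ← sum_range_four_mul_of_periodic c₂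
        (fun m ↦ cexp (2 * Real.pi * I * ((a * m ^ 2 + a * m : ℤ) : ℂ) / c₂)), Finset.mul_sum]
      · refine Finset.sum_congr rfl fun m _ ↦ ?_
        rw [← Complex.exp_add]
        refine cexp_eq_cexp_of_sub_eq 0 ?_
        rw [hc]; push_cast; field_simp; ring
      · intro u j
        refine cexp_eq_cexp_of_sub_eq (a * (2 * u * j + c₂ * j ^ 2 + j)) ?_
        push_cast; field_simp; ring
    rw [this, hG, mul_zero, mul_zero]
  rw [hA, hB, neg_zero, add_zero]

end HSum

/-! ### (v) The transformation law of `Θ′` on `Γ₀(64)` (`c > 0`) -/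

section Assembly

variable {c : ℕ} [NeZero c]

open Literature.NumberTheory.EllipticCurves.Tunnell1983 (odd_entry_of_even)

/-- `χ₋₄(k) = 0` for even `k`. [folklore] -/
theorem chiM4_eq_zero_of_even {k : ℤ} (hk : Even k) : chiM4 k = 0 := by
  obtain ⟨j, rfl⟩ := hk
  unfold chiM4
  have h2 : (((j + j : ℤ)) : ZMod 4) = 2 * (j : ZMod 4) := by push_cast; ring
  have : (2 * (j : ZMod 4)) = 0 ∨ (2 * (j : ZMod 4)) = 2 := by
    generalize (j : ZMod 4) = x
    fin_cases x <;> decide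
  rw [h2]
  rcases this with h | h
  · rw [h, show ZMod.χ₄ (0 : ZMod 4) = 0 by decide, Int.cast_zero]
  · rw [h, show ZMod.χ₄ (2 : ZMod 4) = 0 by decide, Int.cast_zero]

omit [NeZero c] in
/-- `a d = 1 (mod c)` for `γ = (a b; c d)`. [folklore] -/
theorem ad_eq_one_zmod {γ : SL(2, ℤ)} (hc : (γ 1 0 : ℤ) = c) :
    ((γ 0 0 : ℤ) : ZMod c) * ((γ 1 1 : ℤ) : ZMod c) = 1 := by
  have h1 := det_eq_one' γ
  rw [hc] at h1
  have : (((γ 0 0 : ℤ) * γ 1 1 - γ 0 1 * c : ℤ) : ZMod c) = ((1 : ℤ) : ZMod c) := by rw [h1]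
  push_cast at this
  rw [ZMod.natCast_self, mul_zero, sub_zero] at this
  exact this

omit [NeZero c] in
/-- The class of `d k'` modulo `4` is `1` or `3` for `d`, `k'` odd. [folklore] -/
theorem castHom_neg_odd (h4 : 4 ∣ c) {d k' : ℤ} (hd : Odd d) (hk : Odd k') :
    ZMod.castHom h4 (ZMod 4) (((d : ZMod c)) * (k' : ZMod c)) = 1 ∨
    ZMod.castHom h4 (ZMod 4) (((d : ZMod c)) * (k' : ZMod c)) = 3 := by
  rw [map_mul, map_intCast, map_intCast]
  have hdk : Odd (d * k') := hd.mul hk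
  have h2 : (d * k') % 2 = 1 := Int.odd_iff.mp hdk
  have : (d * k') % 4 = 1 ∨ (d * k') % 4 = 3 := by omega
  rw [← Int.cast_mul]
  rcases this with h | h
  · left; rw [← ZMod.intCast_mod (d * k') 4, show (d * k') % ((4 : ℕ) : ℤ) = 1 by exact_mod_cast h]; rfl
  · right; rw [← ZMod.intCast_mod (d * k') 4, show (d * k') % ((4 : ℕ) : ℤ) = 3 by exact_mod_cast h]; rfl

/-- **The terms of the transformed series collapse to `8 G(a; c/16) χ₋₄(-d) · (χ₋₄(k') k' e(k'² z))`**
on `k = 2k'` (and vanish on odd `k`), for `64 ∣ c`. [folklore] -/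
theorem transform_term_two_mul {γ : SL(2, ℤ)} (hc : (γ 1 0 : ℤ) = c) (h64 : 64 ∣ c) (h4 : 4 ∣ c)
    (c₂ : ℕ) [NeZero c₂] (hcc : c = 16 * c₂) (z : ℍ) (k' : ℤ) :
    ((2 * k' : ℤ) : ℂ) * cexp (Real.pi * I * ((2 * k' : ℤ) : ℂ) ^ 2 * (((c : ℂ) * z + γ 1 1) / (2 * c))) *
        chiGaussSum h4 (γ 0 0) ((2 * k' : ℤ) : ZMod c) =
      8 * quadGaussSum c₂ (γ 0 0) 0 * ((ZMod.χ₄ (-((γ 1 1 : ℤ) : ZMod 4)) : ℤ) : ℂ) * thetaChiTerm z k' := by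
  set a : ℤ := γ 0 0 with ha
  set d : ℤ := γ 1 1 with hd
  have h16 : 16 ∣ c := dvd_trans (by norm_num) h64
  have h8 : 8 ∣ c := dvd_trans (by norm_num) h64
  have hc0 : (c : ℂ) ≠ 0 := Nat.cast_ne_zero.mpr (NeZero.ne c)
  have haodd : Odd a := odd_entry_of_even hc ⟨c / 2, by obtain ⟨q, hq⟩ := h4; omega⟩
  have hdodd : Odd d := by
    have h1 := det_eq_one' γ
    rw [hc, ← ha, ← hd] at h1
    by_contra hev
    rw [Int.not_odd_iff_even] at hev
    obtain ⟨q, hq⟩ := h4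
    have : Even (a * d - γ 0 1 * c) := by
      rw [hq]; push_cast
      exact (hev.mul_left a).sub ⟨γ 0 1 * 2 * q, by ring⟩
    rw [h1] at this
    exact Int.not_even_one this
  have e2k : ((2 * k' : ℤ) : ZMod c) = 2 * (k' : ZMod c) := by push_cast; ring
  rw [e2k]
  rcases Int.even_or_odd k' with hk | hk
  · -- `k'` even: both sides vanish
    rw [chiGaussSum_eq_zero_of_even h16 h4 haodd hk, mul_zero]
    rw [thetaChiTerm, chiM4_eq_zero_of_even hk]; ring
  · -- `k'` odd: complete the square with `ā = d`
    have had : ((a : ℤ) : ZMod c) * ((d : ℤ) : ZMod c) = 1 := ad_eq_one_zmod hc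
    have hu := castHom_neg_odd h4 hdodd hk
    rw [chiGaussSum_two_mul_of_odd h4 had hu, hSum_eq h64 h4 haodd c₂ hcc]
    -- the character: `χ₋₄(-d k') = χ₋₄(-d) χ₋₄(k')`
    have hchar : ((ZMod.χ₄ (-(ZMod.castHom h4 (ZMod 4) (((d : ZMod c)) * (k' : ZMod c)))) : ℤ) : ℂ) =
        ((ZMod.χ₄ (-((d : ℤ) : ZMod 4)) : ℤ) : ℂ) * chiM4 k' := by
      unfold chiM4
      rw [map_mul (ZMod.castHom h4 (ZMod 4)), map_intCast, map_intCast, neg_mul_eq_neg_mul, map_mul,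
        Int.cast_mul]
    rw [hchar]
    -- the exponentials: `e(k'² w/c) ψ(-d k'²) = e(k'² z)`
    have hpsi : (ZMod.stdAddChar (-((d : ZMod c) * (k' : ZMod c) ^ 2)) : ℂ) =
        cexp (2 * Real.pi * I * ((-(d * k' ^ 2) : ℤ) : ℂ) / c) := by
      rw [← ZMod.stdAddChar_coe]; congr 1; push_cast; ring
    rw [hpsi, thetaChiTerm]
    have hexp : cexp (Real.pi * I * ((2 * k' : ℤ) : ℂ) ^ 2 * (((c : ℂ) * z + d) / (2 * c))) *
        cexp (2 * Real.pi * I * ((-(d * k' ^ 2) : ℤ) : ℂ) / c) = cexp (2 * Real.pi * I * k' ^ 2 * (z : ℂ)) := by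
      rw [← Complex.exp_add]
      refine cexp_eq_cexp_of_sub_eq 0 ?_
      push_cast; field_simp; ring
    push_cast at hexp ⊢
    linear_combination (8 * quadGaussSum c₂ a 0 * ((ZMod.χ₄ (-((d : ℤ) : ZMod 4)) : ℤ) : ℂ) *
      chiM4 k' * (k' : ℂ)) * hexp

/-- **`Θ′(γz) = -4 (cz+d) (2ic/(cz+d))^{-1/2} G(a; c/16) χ₋₄(-d) Θ′(z)`** for `γ = (a b; c d)`,
`c > 0`, `64 ∣ c`. [cite: Shimura1973HalfIntegral, §2 Prop. 2.2] -/
theorem thetaChi_smul_of_dvd {γ : SL(2, ℤ)} (hc : (γ 1 0 : ℤ) = c) (h64 : 64 ∣ c)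
    (c₂ : ℕ) [NeZero c₂] (hcc : c = 16 * c₂) (z : ℍ) :
    thetaChi (γ • z) =
      -4 * ((c : ℂ) * z + γ 1 1) * (1 / (2 * I * c / ((c : ℂ) * z + γ 1 1)) ^ (1 / 2 : ℂ)) *
        quadGaussSum c₂ (γ 0 0) 0 * ((ZMod.χ₄ (-((γ 1 1 : ℤ) : ZMod 4)) : ℤ) : ℂ) * thetaChi z := by
  have h4 : 4 ∣ c := dvd_trans (by norm_num) h64
  have h8 : 8 ∣ c := dvd_trans (by norm_num) h64
  rw [thetaChi_smul_eq_tsum hc h4 z]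
  set w : ℂ := (c : ℂ) * z + γ 1 1 with hw
  have hw_im : 0 < w.im := im_denom_pos (γ 1 1) z
  -- the series: even part `= 8 G χ Θ′(z)`, odd part `= 0`
  set T : ℤ → ℂ := fun k ↦ (k : ℂ) * cexp (Real.pi * I * k ^ 2 * (w / (2 * c))) *
    chiGaussSum h4 (γ 0 0) k with hT
  have hsumT : Summable T := summable_thetaChiTransform h4 _ hw_im
  have heven : HasSum (fun k' : ℤ ↦ T (2 * k'))
      (8 * quadGaussSum c₂ (γ 0 0) 0 * ((ZMod.χ₄ (-((γ 1 1 : ℤ) : ZMod 4)) : ℤ) : ℂ) * thetaChi z) := by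
    have h := (hasSum_thetaChi z).mul_left
      (8 * quadGaussSum c₂ (γ 0 0) 0 * ((ZMod.χ₄ (-((γ 1 1 : ℤ) : ZMod 4)) : ℤ) : ℂ))
    refine h.congr_fun fun k' ↦ ?_
    rw [hT]
    dsimp only
    have := transform_term_two_mul hc h64 h4 c₂ hcc z k'
    rw [← hw] at this
    push_cast at this ⊢
    exact this
  have hodd : HasSum (fun k' : ℤ ↦ T (2 * k' + 1)) 0 := by
    have : (fun k' : ℤ ↦ T (2 * k' + 1)) = 0 := by
      funext k'
      rw [hT]
      dsimp only
      rw [chiGaussSum_eq_zero_of_odd h8 h4 _ ⟨k', rfl⟩, mul_zero]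
      rfl
    rw [this]
    exact hasSum_zero
  have htot := hasSum_int_even_add_odd heven hodd
  rw [add_zero] at htot
  rw [htot.tsum_eq]
  ring

/-- **The mixed law `Θ′(γz) θ(z) = -χ₋₄(-d) (cz+d) θ(γz) Θ′(z)`** (`c > 0`, `64 ∣ c`): compare with
`θ(γz) = (2ic/(cz+d))^{-1/2} G(a; c) θ(z)` and `G(a; c) = 4 G(a; c/16)`. [folklore] -/
theorem thetaChi_smul_mul_theta {γ : SL(2, ℤ)} (hc : (γ 1 0 : ℤ) = c) (h64 : 64 ∣ c) (z : ℍ) :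
    thetaChi (γ • z) * shimuraTheta z =
      -((ZMod.χ₄ (-((γ 1 1 : ℤ) : ZMod 4)) : ℤ) : ℂ) * ((c : ℂ) * z + γ 1 1) *
        shimuraTheta (γ • z) * thetaChi z := by
  obtain ⟨c₂, hcc⟩ : ∃ c₂, c = 16 * c₂ := by obtain ⟨q, hq⟩ := h64; exact ⟨4 * q, by omega⟩
  haveI : NeZero c₂ := ⟨by rintro rfl; exact NeZero.ne c (by omega)⟩
  have h4 : 4 ∣ c := dvd_trans (by norm_num) h64
  have hc₂4 : 4 ∣ c₂ := by obtain ⟨q, hq⟩ := h64; exact ⟨q, by omega⟩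
  haveI : NeZero (4 * c₂) := ⟨by have := NeZero.ne c₂; omega⟩
  have haodd : Odd (γ 0 0 : ℤ) := odd_entry_of_even hc ⟨c / 2, by obtain ⟨q, hq⟩ := h4; omega⟩
  have hG : quadGaussSum c (γ 0 0) 0 = 4 * quadGaussSum c₂ (γ 0 0) 0 := by
    rw [quadGaussSum_four_mul' (c := c) (m := 4 * c₂) (by omega) ⟨c₂, rfl⟩ haodd,
      quadGaussSum_four_mul' (c := 4 * c₂) (m := c₂) rfl hc₂4 haodd]
    ring
  rw [thetaChi_smul_of_dvd hc h64 c₂ hcc z, shimuraTheta_smul_eq_of_four_dvd hc h4 z, hG]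
  ring

end Assembly

end Literature.NumberTheory.EllipticCurves.ModularForms
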